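import Summits.ResolutionOfSingularities.ResolutionOfSingularities.Theorems.RadicialJungCleanModelsSufficeAdaptedKN
import Summits.ResolutionOfSingularities.ResolutionOfSingularities.Theorems.RadicialJungCleanModelsSufficeReduction

/-!
# Crux `CleanModelsSuffice` (stmt-ResolutionOfSingularities-15883), line `Sketch` — the reductions WITHOUT Kato (4.1)

Route `ResolutionOfSingularities/RadicialJung`, crux `CleanModelsSuffice` (`∀ p prime, PIAlt_p → CleanModels_p →
ResolutionInChar p`). Skeleton v3.2 of the line `Sketch` has eliminated the named fact Kato 1994 (4.1) ("log regular ⇒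
normal"): its only use — the Kummer order over a regular local ring is integrally closed — is the theorem
`kummerNormal` (`…ChartsKN`), and an adapted model's normalisation is resolved by Kato (10.4) alone (`stub_adaptedKN`,
`…AdaptedKN`). This file re-plumbs the three reductions of `…Reduction` / `…ReductionR` accordingly:

* `hasResolution_normalizationIn_of_adaptedModelKN` — a proper birational regular model `V → W` with PAIRWISE ADAPTED
  log-clean data resolves `W^L`, granted Kato (10.4);
* `cleanModelsSuffice_of_kato_of_gameKN : Kato (10.4) → Game → CleanModelsSuffice` — the crux is kernel-checked
  closed modulo {Kato (10.4), the exceptionalisation game `stub_exceptionalise`};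
* `resolutionInChar_of_kato_of_adaptedModelsKN : Kato (10.4) → PIAlt_p → CleanModelsR_p → ResolutionInChar p` — the
  RIDER form (clean models stated with pairwise adapted data), now conditional on Kato (10.4) only.
-/

noncomputable section

set_option linter.dupNamespace false -- mandated namespace of this single-conjunct summit

open CategoryTheory CategoryTheory.Limits AlgebraicGeometry TopologicalSpace
open Literature.AlgebraicGeometry.Resolution Literature.AlgebraicGeometry.Motives
open Summit.ResolutionOfSingularities.ResolutionOfSingularities.Theorems.Picover
open IsLocalRing

namespace Summit.ResolutionOfSingularities.ResolutionOfSingularities.Theorems.RadicialJung.CleanModelsSuffice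

/-- **A model with pairwise adapted log-clean data resolves the normalisation of the base in `L`**, granted
Kato (10.4): transport `L` to a `K(V)`-algebra along `π^♯ : K(W) ≅ K(V)`, bundle the game's output as
`AdaptedData p V L`, resolve `V^L` by `stub_adaptedKN` (Kato (10.4) on the unconditional Kato charts),
and descend along the proper birational `V^L → W^L`. (= `hasResolution_normalizationIn_of_adaptedModel`
without `hK4`.) [folklore] -/
theorem hasResolution_normalizationIn_of_adaptedModelKN
    (hK : Kato1994_logRegularScheme_hasResolution.{0})
    (p : ℕ) (hp : p.Prime) (k : Type) [Field k] [CharP k p]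
    (W : Scheme.{0}) [IsIntegral W] (f : W ⟶ Spec (.of k)) (L : Type) [Field L]
    [Algebra W.functionField L] [IsSeparated f] [LocallyOfFiniteType f] [QuasiCompact f]
    [IsPurelyInseparable W.functionField L] (hdeg : Module.finrank W.functionField L = p)
    (V : Scheme.{0}) (π : V ⟶ W) [IsIntegral V] [IsDominant π] [IsProper π]
    (hbir : IsBirational π) (hVreg : Scheme.IsRegular V)
    (hRv :
      ∃ (y : V → L) (g : V → W.functionField) (d r m : V → ℕ) (hrd : ∀ v, r v ≤ d v)
        (hmr : ∀ v, m v ≤ r v) (t : ∀ v : V, Fin (d v) → V.presheaf.stalk v) (a : ∀ v : V, Fin (m v) → ℕ)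
        (U : V → V.Opens) (hU : ∀ v, v ∈ U v) (s : ∀ v : V, Fin (r v) → Γ(V, U v)),
        (∀ v : V, y v ∉ Set.range (algebraMap W.functionField L) ∧
          algebraMap W.functionField L (g v) = y v ^ p ∧
          Ideal.span (Set.range (t v)) = IsLocalRing.maximalIdeal (V.presheaf.stalk v) ∧
          ringKrullDim (V.presheaf.stalk v) = (d v : WithBot ℕ∞) ∧
          (∀ i : Fin (r v), V.presheaf.germ (U v) v (hU v) (s v i) = t v (Fin.castLE (hrd v) i)) ∧
          (∀ i : Fin (m v), ¬ p ∣ a v i) ∧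
          ((0 < m v ∧ RatFn.functionFieldMap π (g v) = ∏ i : Fin (m v),
              (algebraMap (V.presheaf.stalk v) V.functionField
                (t v (Fin.castLE ((hmr v).trans (hrd v)) i))) ^ (a v i)) ∨
            (m v = 0 ∧ ∃ u₀ : V.presheaf.stalk v, IsUnit u₀ ∧
              RatFn.functionFieldMap π (g v) = algebraMap (V.presheaf.stalk v) V.functionField u₀ ∧
              ((∀ x : V.presheaf.stalk v, u₀ - x ^ p ∉ IsLocalRing.maximalIdeal (V.presheaf.stalk v)) ∨
                (∃ x : V.presheaf.stalk v, u₀ - x ^ p ∈ IsLocalRing.maximalIdeal (V.presheaf.stalk v) ∧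
                  u₀ - x ^ p ∉ IsLocalRing.maximalIdeal (V.presheaf.stalk v) ^ 2 ⊔
                    Ideal.span (Set.range fun i : Fin (r v) => t v (Fin.castLE (hrd v) i))))))) ∧
        (∀ (v w : V) (hw : w ∈ U v), ∃ (dw : ℕ) (tw : Fin dw → V.presheaf.stalk w) (ι : Fin (r v) → Fin dw),
          Ideal.span (Set.range tw) = IsLocalRing.maximalIdeal (V.presheaf.stalk w) ∧
          ringKrullDim (V.presheaf.stalk w) = (dw : WithBot ℕ∞) ∧
          (∀ i : Fin (r v), V.presheaf.germ (U v) w hw (s v i) ∈ IsLocalRing.maximalIdeal (V.presheaf.stalk w) →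
            tw (ι i) = V.presheaf.germ (U v) w hw (s v i)) ∧
          (∀ i j : Fin (r v), V.presheaf.germ (U v) w hw (s v i) ∈ IsLocalRing.maximalIdeal (V.presheaf.stalk w) →
            V.presheaf.germ (U v) w hw (s v j) ∈ IsLocalRing.maximalIdeal (V.presheaf.stalk w) → ι i = ι j → i = j)) ∧
        (∀ (v v' w : V) (hw : w ∈ U v) (hw' : w ∈ U v'), ∃ μ : ℕ, ¬ p ∣ μ ∧ ∀ i : Fin (r v),
          V.presheaf.germ (U v) w hw (s v i) ∈ IsLocalRing.maximalIdeal (V.presheaf.stalk w) →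
          ∃ i' : Fin (r v'), Associated (V.presheaf.germ (U v) w hw (s v i))
              (V.presheaf.germ (U v') w hw' (s v' i')) ∧
            ((i : ℕ) < m v ↔ (i' : ℕ) < m v') ∧
            (∀ (hi : (i : ℕ) < m v) (hi' : (i' : ℕ) < m v'), a v' ⟨i', hi'⟩ ≡ μ * a v ⟨i, hi⟩ [MOD p]))) :
    Scheme.HasResolution (normalizationIn W L) := by
  -- `π^♯ : K(W) ≅ K(V)`
  have hbij : Function.Bijective (RatFn.functionFieldMap π) :=
    TowerTransport.bijective_functionFieldMap_of_isIso π hbir.isIso_stalkMap_genericPoint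
  let eK : W.functionField ≃+* V.functionField := RingEquiv.ofBijective _ hbij
  have heK : ∀ x, eK x = RatFn.functionFieldMap π x := fun _ => rfl
  -- `L` as a `K(V)`-algebra
  letI : Algebra V.functionField L :=
    ((algebraMap W.functionField L).comp eK.symm.toRingHom).toAlgebra
  have halg : algebraMap V.functionField L =
      (algebraMap W.functionField L).comp eK.symm.toRingHom := rfl
  have hcompat : (algebraMap V.functionField L).comp (RatFn.functionFieldMap π) =
      algebraMap W.functionField L := by
    refine RingHom.ext fun x => ?_
    rw [halg, RingHom.comp_apply, RingHom.comp_apply, ← heK]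
    exact congrArg (algebraMap W.functionField L) (eK.symm_apply_apply x)
  have halg_apply : ∀ g : W.functionField,
      algebraMap V.functionField L (RatFn.functionFieldMap π g) = algebraMap W.functionField L g :=
    fun g => congrArg (fun φ : W.functionField →+* L => φ g) hcompat
  have hrange : Set.range (algebraMap V.functionField L) =
      Set.range (algebraMap W.functionField L) := by
    ext z
    constructor
    · rintro ⟨x, rfl⟩
      exact ⟨eK.symm x, by rw [halg]; rfl⟩
    · rintro ⟨x, rfl⟩
      exact ⟨RatFn.functionFieldMap π x, halg_apply x⟩
  -- degree `p`, purely inseparable, characteristic `p`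
  have hdeg' : Module.finrank V.functionField L = p := by
    rw [← hdeg]
    exact Algebra.finrank_eq_of_equiv_equiv eK.symm (RingEquiv.refl L) (by ext x; simp [halg])
  haveI : FiniteDimensional W.functionField L :=
    Module.finite_of_finrank_pos (by rw [hdeg]; exact hp.pos)
  haveI : FiniteDimensional V.functionField L :=
    Module.finite_of_finrank_pos (by rw [hdeg']; exact hp.pos)
  haveI : CharP W.functionField p := TowerTransport.charP_functionField W f
  haveI : CharP V.functionField p := TowerTransport.charP_functionField V (π ≫ f)
  haveI : ExpChar W.functionField p := ExpChar.prime hp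
  haveI : ExpChar V.functionField p := ExpChar.prime hp
  haveI : IsPurelyInseparable V.functionField L :=
    TowerTransport.isPurelyInseparable_of_ringEquiv_base (p := p) eK.symm halg.symm
  -- bundle the adapted data over `V` (for the structure morphism `π ≫ f`)
  obtain ⟨y, g, d, r, m, hrd, hmr, t, a, U, hU, s, hpt, hsop, hov⟩ := hRv
  let D : AdaptedData p V L :=
    { y := y, g := fun v => RatFn.functionFieldMap π (g v), d := d, r := r, m := m, hrd := hrd, hmr := hmr,
      t := t, a := a, U := U, hU := hU, s := s,
      pointwise := fun v => by
        obtain ⟨hy, hg, hrest⟩ := hpt v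
        refine ⟨?_, ?_, hrest⟩
        · rw [hrange]; exact hy
        · rw [halg_apply]; exact hg,
      jointSop := hsop, overlap := hov }
  -- Kato (10.4) on the log-regular atlas of `V^L`, through `stub_adaptedKN`
  have hres' : Scheme.HasResolution (normalizationIn V L) :=
    stub_adaptedKN hK p hp k V (π ≫ f) L hVreg hdeg' D
  -- descend along `V^L → W^L`
  exact CleanResolves.hasResolution_normalizationIn_of_isBirational W f L V π hbir hcompat hres'

/-- **REDUCTION (sorry-free): the crux `CleanModelsSuffice` follows from Kato 1994 (10.4) ALONE and the
exceptionalisation game.** The registered skeleton `Cruxes/CleanModelsSuffice/Lines/Sketch.lean` (v3.2) with its two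
remaining stubs turned into hypotheses: `hK` = Kato 1994 (10.4) (`Kato1994_logRegularScheme_hasResolution`, named fact)
and `hGame` = the registered statement of `stub_exceptionalise` (a pointwise log-clean regular model has a further proper
birational regular model with PAIRWISE ADAPTED clean data). Compared with `cleanModelsSuffice_of_kato_of_game` (v2.9)
the hypothesis Kato 1994 (4.1) is GONE (replaced by the proved Kummer normality): the crux is kernel-checked closed
modulo {Kato (10.4), the game}. [folklore] -/
theorem cleanModelsSuffice_of_kato_of_gameKN
    (hK : Kato1994_logRegularScheme_hasResolution.{0})
    (hGame : ∀ (p : ℕ) (hp : p.Prime) (k : Type) [Field k] [CharP k p]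
      (V : Scheme.{0}) [IsIntegral V] (f : V ⟶ Spec (.of k)) (L : Type) [Field L]
      [Algebra V.functionField L] [IsSeparated f] [LocallyOfFiniteType f] [QuasiCompact f]
      (hVreg : Scheme.IsRegular V) [IsPurelyInseparable V.functionField L]
      (hdeg : Module.finrank V.functionField L = p)
      (hclean : ∀ v : V, ∃ (y : L) (g : V.functionField),
        y ∉ Set.range (algebraMap V.functionField L) ∧ algebraMap V.functionField L g = y ^ p ∧
        ((∃ (d m : ℕ) (hmd : m ≤ d) (t : Fin d → V.presheaf.stalk v) (a : Fin m → ℕ),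
            Ideal.span (Set.range t) = IsLocalRing.maximalIdeal (V.presheaf.stalk v) ∧
            ringKrullDim (V.presheaf.stalk v) = (d : WithBot ℕ∞) ∧ 0 < m ∧ (∀ i, ¬ p ∣ a i) ∧
            g = ∏ i : Fin m,
              (algebraMap (V.presheaf.stalk v) V.functionField (t (Fin.castLE hmd i))) ^ (a i)) ∨
          (∃ u₀ : V.presheaf.stalk v, IsUnit u₀ ∧
            g = algebraMap (V.presheaf.stalk v) V.functionField u₀ ∧
            ((∀ c : V.presheaf.stalk v,
                u₀ - c ^ p ∉ IsLocalRing.maximalIdeal (V.presheaf.stalk v)) ∨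
              (∃ c : V.presheaf.stalk v,
                u₀ - c ^ p ∈ IsLocalRing.maximalIdeal (V.presheaf.stalk v) ∧
                u₀ - c ^ p ∉ IsLocalRing.maximalIdeal (V.presheaf.stalk v) ^ 2))))),
      ∃ (V' : Scheme.{0}) (π' : V' ⟶ V) (_ : IsIntegral V') (_ : IsDominant π'),
        IsProper π' ∧ IsBirational π' ∧ Scheme.IsRegular V' ∧
        ∃ (y : V' → L) (g : V' → V.functionField) (d r m : V' → ℕ) (hrd : ∀ v, r v ≤ d v)
          (hmr : ∀ v, m v ≤ r v) (t : ∀ v : V', Fin (d v) → V'.presheaf.stalk v) (a : ∀ v : V', Fin (m v) → ℕ)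
          (U : V' → V'.Opens) (hU : ∀ v, v ∈ U v) (s : ∀ v : V', Fin (r v) → Γ(V', U v)),
          (∀ v : V', y v ∉ Set.range (algebraMap V.functionField L) ∧
            algebraMap V.functionField L (g v) = y v ^ p ∧
            Ideal.span (Set.range (t v)) = IsLocalRing.maximalIdeal (V'.presheaf.stalk v) ∧
            ringKrullDim (V'.presheaf.stalk v) = (d v : WithBot ℕ∞) ∧
            (∀ i : Fin (r v), V'.presheaf.germ (U v) v (hU v) (s v i) = t v (Fin.castLE (hrd v) i)) ∧
            (∀ i : Fin (m v), ¬ p ∣ a v i) ∧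
            ((0 < m v ∧ RatFn.functionFieldMap π' (g v) = ∏ i : Fin (m v),
                (algebraMap (V'.presheaf.stalk v) V'.functionField
                  (t v (Fin.castLE ((hmr v).trans (hrd v)) i))) ^ (a v i)) ∨
              (m v = 0 ∧ ∃ u₀ : V'.presheaf.stalk v, IsUnit u₀ ∧
                RatFn.functionFieldMap π' (g v) = algebraMap (V'.presheaf.stalk v) V'.functionField u₀ ∧
                ((∀ x : V'.presheaf.stalk v, u₀ - x ^ p ∉ IsLocalRing.maximalIdeal (V'.presheaf.stalk v)) ∨
                  (∃ x : V'.presheaf.stalk v, u₀ - x ^ p ∈ IsLocalRing.maximalIdeal (V'.presheaf.stalk v) ∧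
                    u₀ - x ^ p ∉ IsLocalRing.maximalIdeal (V'.presheaf.stalk v) ^ 2 ⊔
                      Ideal.span (Set.range fun i : Fin (r v) => t v (Fin.castLE (hrd v) i))))))) ∧
          (∀ (v w : V') (hw : w ∈ U v), ∃ (dw : ℕ) (tw : Fin dw → V'.presheaf.stalk w) (ι : Fin (r v) → Fin dw),
            Ideal.span (Set.range tw) = IsLocalRing.maximalIdeal (V'.presheaf.stalk w) ∧
            ringKrullDim (V'.presheaf.stalk w) = (dw : WithBot ℕ∞) ∧
            (∀ i : Fin (r v), V'.presheaf.germ (U v) w hw (s v i) ∈ IsLocalRing.maximalIdeal (V'.presheaf.stalk w) →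
              tw (ι i) = V'.presheaf.germ (U v) w hw (s v i)) ∧
            (∀ i j : Fin (r v), V'.presheaf.germ (U v) w hw (s v i) ∈ IsLocalRing.maximalIdeal (V'.presheaf.stalk w) →
              V'.presheaf.germ (U v) w hw (s v j) ∈ IsLocalRing.maximalIdeal (V'.presheaf.stalk w) → ι i = ι j → i = j)) ∧
          (∀ (v v' w : V') (hw : w ∈ U v) (hw' : w ∈ U v'), ∃ μ : ℕ, ¬ p ∣ μ ∧ ∀ i : Fin (r v),
            V'.presheaf.germ (U v) w hw (s v i) ∈ IsLocalRing.maximalIdeal (V'.presheaf.stalk w) →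
            ∃ i' : Fin (r v'), Associated (V'.presheaf.germ (U v) w hw (s v i))
                (V'.presheaf.germ (U v') w hw' (s v' i')) ∧
              ((i : ℕ) < m v ↔ (i' : ℕ) < m v') ∧
              (∀ (hi : (i : ℕ) < m v) (hi' : (i' : ℕ) < m v'), a v' ⟨i', hi'⟩ ≡ μ * a v ⟨i, hi⟩ [MOD p]))) :
    Summit.ResolutionOfSingularities.ResolutionOfSingularities.Theses.RadicialJung.CleanModelsSuffice := by
  -- (1) the `π = 𝟙` case of `CleanResolves`
  have hSelf : ∀ p : ℕ, p.Prime → ∀ (k : Type) [Field k] [CharP k p] (V : Scheme.{0}) [IsIntegral V]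
      (f : V ⟶ Spec (.of k)) (L : Type) [Field L] [Algebra V.functionField L],
      IsSeparated f → LocallyOfFiniteType f → QuasiCompact f → Scheme.IsRegular V →
      IsPurelyInseparable V.functionField L → Module.finrank V.functionField L = p →
      (∀ v : V, ∃ (y : L) (g : V.functionField), y ∉ Set.range (algebraMap V.functionField L) ∧
        algebraMap V.functionField L g = y ^ p ∧
        ((∃ (d m : ℕ) (hmd : m ≤ d) (t : Fin d → V.presheaf.stalk v) (a : Fin m → ℕ),
            Ideal.span (Set.range t) = IsLocalRing.maximalIdeal (V.presheaf.stalk v) ∧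
            ringKrullDim (V.presheaf.stalk v) = (d : WithBot ℕ∞) ∧ 0 < m ∧ (∀ i, ¬ p ∣ a i) ∧
            g = ∏ i : Fin m,
              (algebraMap (V.presheaf.stalk v) V.functionField (t (Fin.castLE hmd i))) ^ (a i)) ∨
          (∃ u₀ : V.presheaf.stalk v, IsUnit u₀ ∧
            g = algebraMap (V.presheaf.stalk v) V.functionField u₀ ∧
            ((∀ c : V.presheaf.stalk v,
                u₀ - c ^ p ∉ IsLocalRing.maximalIdeal (V.presheaf.stalk v)) ∨
              (∃ c : V.presheaf.stalk v,
                u₀ - c ^ p ∈ IsLocalRing.maximalIdeal (V.presheaf.stalk v) ∧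
                u₀ - c ^ p ∉ IsLocalRing.maximalIdeal (V.presheaf.stalk v) ^ 2))))) →
      Scheme.HasResolution (normalizationIn V L) := by
    intro p hp k _ _ V _ f L _ _ hsep hloc hqc hVreg hPI hdeg hclean
    haveI := hsep; haveI := hloc; haveI := hqc; haveI := hPI
    obtain ⟨V', π', hV'int, hdom, hprop, hbir, hV'reg, hRv⟩ :=
      hGame p hp k V f L hVreg hdeg hclean
    haveI := hV'int; haveI := hdom; haveI := hprop
    exact hasResolution_normalizationIn_of_adaptedModelKN hK p hp k V f L hdeg V' π' hbir hV'reg hRv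
  -- (2) `CleanResolves` from its `π = 𝟙` case (proved in tree)
  have hCR : Summit.ResolutionOfSingularities.ResolutionOfSingularities.Theses.RadicialJung.CleanResolves :=
    CleanResolves.cleanResolves_of_self hSelf
  -- (3) the frame at the fixed prime
  intro p hp hPI hCM
  have hDegP : ∀ (k : Type) [Field k] [CharP k p] (W : Scheme.{0}) [IsIntegral W]
      (f : W ⟶ Spec (.of k)) (L : Type) [Field L] [Algebra W.functionField L],
      IsSeparated f → LocallyOfFiniteType f → QuasiCompact f → Scheme.IsRegular W →
      IsPurelyInseparable W.functionField L → Module.finrank W.functionField L = p →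
      Scheme.HasResolution (normalizationIn W L) := by
    intro k _ _ W _ f L _ _ hs hl hq hr hpi hd
    obtain ⟨V, π, hVi, hdom, hV⟩ := hCM k W f L hs hl hq hr hpi hd
    exact hCR p hp k W f L hs hl hq hr hpi hd V π hV
  exact (palterationThesisAt_iff_resolutionInChar p hp).mp ⟨hPI, picoverAt_of_degPAt p hp hDegP⟩

/-- **The rider form of the crux, modulo Kato.** For a prime `p`: if every integral separated finite-type scheme over a
field of characteristic `p` has a regular purely-inseparable alteration (`PIAlt_p`, the first hypothesis of the crux
verbatim) and every degree-`p` purely inseparable extension of the function field of a regular such scheme has a proper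
birational regular model with PAIRWISE ADAPTED log-clean data (`CleanModelsR_p`), then — granted Kato 1994 (10.4)
`hK` ALONE (Kato (4.1) is replaced by the proved Kummer normality) — resolution of singularities holds in
characteristic `p`. This is the lead's RIDER: were `CleanModels` (stmt-ResolutionOfSingularities-15917) restated with
the pairwise adapted clause, the crux would close from this theorem conditional on Kato (10.4) only. [folklore] -/
theorem resolutionInChar_of_kato_of_adaptedModelsKN
    (hK : Kato1994_logRegularScheme_hasResolution.{0})
    (p : ℕ) (hp : p.Prime)
    (hPI : ∀ (k : Type) [Field k] [CharP k p] (X : Scheme.{0}) (f : X ⟶ Spec (.of k)),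
      IsSeparated f → LocallyOfFiniteType f → QuasiCompact f → IsIntegral X →
      ∃ (X' : Scheme.{0}) (g : X' ⟶ X), IsProper g ∧ IsIntegral X' ∧ Scheme.IsRegular X' ∧
        Function.Surjective g.base ∧ ∃ U : X.Opens, Dense (U : Set X) ∧
          IsFinite (g ∣_ U) ∧ UniversallyInjective (g ∣_ U))
    (hCMR : ∀ (k : Type) [Field k] [CharP k p] (W : Scheme.{0}) [IsIntegral W] (f : W ⟶ Spec (.of k))
      (L : Type) [Field L] [Algebra W.functionField L],
      IsSeparated f → LocallyOfFiniteType f → QuasiCompact f → Scheme.IsRegular W →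
      IsPurelyInseparable W.functionField L → Module.finrank W.functionField L = p →
      ∃ (V : Scheme.{0}) (π : V ⟶ W) (_ : IsIntegral V) (_ : IsDominant π),
        IsProper π ∧ IsBirational π ∧ Scheme.IsRegular V ∧

        ∃ (y : V → L) (g : V → W.functionField) (d r m : V → ℕ) (hrd : ∀ v, r v ≤ d v)
          (hmr : ∀ v, m v ≤ r v) (t : ∀ v : V, Fin (d v) → V.presheaf.stalk v) (a : ∀ v : V, Fin (m v) → ℕ)
          (U : V → V.Opens) (hU : ∀ v, v ∈ U v) (s : ∀ v : V, Fin (r v) → Γ(V, U v)),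
          (∀ v : V, y v ∉ Set.range (algebraMap W.functionField L) ∧
            algebraMap W.functionField L (g v) = y v ^ p ∧
            Ideal.span (Set.range (t v)) = IsLocalRing.maximalIdeal (V.presheaf.stalk v) ∧
            ringKrullDim (V.presheaf.stalk v) = (d v : WithBot ℕ∞) ∧
            (∀ i : Fin (r v), V.presheaf.germ (U v) v (hU v) (s v i) = t v (Fin.castLE (hrd v) i)) ∧
            (∀ i : Fin (m v), ¬ p ∣ a v i) ∧
            ((0 < m v ∧ RatFn.functionFieldMap π (g v) = ∏ i : Fin (m v),
                (algebraMap (V.presheaf.stalk v) V.functionField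
                  (t v (Fin.castLE ((hmr v).trans (hrd v)) i))) ^ (a v i)) ∨
              (m v = 0 ∧ ∃ u₀ : V.presheaf.stalk v, IsUnit u₀ ∧
                RatFn.functionFieldMap π (g v) = algebraMap (V.presheaf.stalk v) V.functionField u₀ ∧
                ((∀ x : V.presheaf.stalk v, u₀ - x ^ p ∉ IsLocalRing.maximalIdeal (V.presheaf.stalk v)) ∨
                  (∃ x : V.presheaf.stalk v, u₀ - x ^ p ∈ IsLocalRing.maximalIdeal (V.presheaf.stalk v) ∧
                    u₀ - x ^ p ∉ IsLocalRing.maximalIdeal (V.presheaf.stalk v) ^ 2 ⊔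
                      Ideal.span (Set.range fun i : Fin (r v) => t v (Fin.castLE (hrd v) i))))))) ∧
          (∀ (v w : V) (hw : w ∈ U v), ∃ (dw : ℕ) (tw : Fin dw → V.presheaf.stalk w) (ι : Fin (r v) → Fin dw),
            Ideal.span (Set.range tw) = IsLocalRing.maximalIdeal (V.presheaf.stalk w) ∧
            ringKrullDim (V.presheaf.stalk w) = (dw : WithBot ℕ∞) ∧
            (∀ i : Fin (r v), V.presheaf.germ (U v) w hw (s v i) ∈ IsLocalRing.maximalIdeal (V.presheaf.stalk w) →
              tw (ι i) = V.presheaf.germ (U v) w hw (s v i)) ∧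
            (∀ i j : Fin (r v), V.presheaf.germ (U v) w hw (s v i) ∈ IsLocalRing.maximalIdeal (V.presheaf.stalk w) →
              V.presheaf.germ (U v) w hw (s v j) ∈ IsLocalRing.maximalIdeal (V.presheaf.stalk w) → ι i = ι j → i = j)) ∧
          (∀ (v v' w : V) (hw : w ∈ U v) (hw' : w ∈ U v'), ∃ μ : ℕ, ¬ p ∣ μ ∧ ∀ i : Fin (r v),
            V.presheaf.germ (U v) w hw (s v i) ∈ IsLocalRing.maximalIdeal (V.presheaf.stalk w) →
            ∃ i' : Fin (r v'), Associated (V.presheaf.germ (U v) w hw (s v i))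
                (V.presheaf.germ (U v') w hw' (s v' i')) ∧
              ((i : ℕ) < m v ↔ (i' : ℕ) < m v') ∧
              (∀ (hi : (i : ℕ) < m v) (hi' : (i' : ℕ) < m v'), a v' ⟨i', hi'⟩ ≡ μ * a v ⟨i, hi⟩ [MOD p]))) :
    ResolutionInChar.{0} p := by
  have hDegP : ∀ (k : Type) [Field k] [CharP k p] (W : Scheme.{0}) [IsIntegral W]
      (f : W ⟶ Spec (.of k)) (L : Type) [Field L] [Algebra W.functionField L],
      IsSeparated f → LocallyOfFiniteType f → QuasiCompact f → Scheme.IsRegular W →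
      IsPurelyInseparable W.functionField L → Module.finrank W.functionField L = p →
      Scheme.HasResolution (normalizationIn W L) := by
    intro k _ _ W _ f L _ _ hs hl hq hr hpi hd
    haveI := hs; haveI := hl; haveI := hq; haveI := hpi
    obtain ⟨V, π, hVi, hdom, hprop, hbir, hVreg, hRv⟩ := hCMR k W f L hs hl hq hr hpi hd
    haveI := hVi; haveI := hdom; haveI := hprop
    exact hasResolution_normalizationIn_of_adaptedModelKN hK p hp k W f L hd V π hbir hVreg hRv
  exact (palterationThesisAt_iff_resolutionInChar p hp).mp ⟨hPI, picoverAt_of_degPAt p hp hDegP⟩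

end Summit.ResolutionOfSingularities.ResolutionOfSingularities.Theorems.RadicialJung.CleanModelsSuffice

end
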